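import Summits.CriticalPhenomena.PercolationContinuityZ3.Theorems.PercNearOneGluingNoHeavyLowerTailTformLightStarInductionOpenChampion
import HarnessLib

/-!
# `NoHeavyLowerTail` (stmt-CriticalPhenomena-4575) — the crux reduced to ONE champion-free gluing property of T-form witnesses

Support file (prover `prim-hp-5`, hull-port cell, T-form calculus, gen 4; `--supports stmt-CriticalPhenomena-4575`).
No definitions, no named facts, no sorries.  `μ = prodBernoulli u` on `Fin n`, relays `A`, level `j`,
`N_y = |π(y)| = |{z ∈ A : y ↔ z}|`, `N_B = |π(B)| = |{z ∈ A : ∃ y ∈ B, y ↔ z}|`, `Φ(x) = μ{N_x ≤ j}`.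

A relay `x` is a (deficit) T-WITNESS for a non-relay observer `y` if, for every relay `c`,
    `μ(1 ≤ N_y ≤ j) + μ(N_c ≤ j) ≤ μ(N_c ≤ j ∧ 1 ≤ N_y) + μ(N_x ≤ j)`                                   (W₁)
(equivalently `μ(1 ≤ N_y ≤ j) + μ(N_y = 0, N_c ≤ j) ≤ Φ(x)`: "`x` is at least as light as the observer `y`"; for
`x` a champion this is the deficit attached-champion inequality XZ⁺ of `…TformLightStarInduction`).  It is a T-witness for
a SET `B` of non-relay vertices (the observer obtained by gluing `B`) if, for every relay `c`,
    `μ(x ≁ B, 1 ≤ N_B ≤ j) + μ(N_B = 0, N_c ≤ j) ≤ μ(x ≁ B, N_x ≤ j)`.                                    (W_B)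

**Glued-witness property (hypothesis `hGlue`, conjecture; this seat's census 2026-08-19: 0 violations in 60 000+ exact
random instances `n ≤ 7`, `|B| ≤ 4`, plus annealing climbs; kit jobs j066624/j066625).**  For EVERY relay `x` (no champion
hypothesis anywhere): if `x` is a T-witness for each member `y ∈ B` then `x` is a T-witness for `B`.

* `lightMultiStarPacking_open_of_gluedWitness` — `hGlue` discharges the hypothesis `hLSP2` of
  `Theorems.attachedChampion_of_lightMultiStarPacking_open`: at a light multi-star `B` of an observer `o` (in `u` = the
  graph with the pairs at `o` off, champion `q`), the induction hypothesis supplied by `xzDeficit_induction_open` says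
  precisely that `q` is a T-witness (W₁) for every `y ∈ B` (each `y` is an observer of `u`, which has fewer positive pairs),
  and `hGlue` turns this into (W_B) = the light-star packing inequality LSP(u, q, c, B).
* `attachedChampion_of_gluedWitness` — hence the registered stub `stub_attachedChampion` (XZ at every champion, every
  observer, every finite weighted graph, every level);
* `noHeavyLowerTail_of_gluedWitness` — hence the crux.

So `NoHeavyLowerTail` follows from a single structural statement about ONE graph and ONE arbitrary relay: T-witnesses are
closed under gluing observers.  (The same-`c` version of the property is false by a hair — exact 6-vertex witness, margin
−8·10⁻⁵ — which is why (W₁) is required for every `c`.)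
-/

noncomputable section

namespace Summit.CriticalPhenomena.PercolationContinuityZ3.Theorems

open MeasureTheory Set Literature.Probability.LatticeModels Literature.Probability.Percolation
open scoped Classical BigOperators

/-- **Glued witnesses discharge the light multi-star packing hypothesis of the open-recursion induction.**
From `hGlue` (T-witnesses are closed under gluing observers) one gets `hLSP2` of
`Theorems.attachedChampion_of_lightMultiStarPacking_open` — verbatim. -/
theorem lightMultiStarPacking_open_of_gluedWitness
    (hGlue : ∀ (n : ℕ) (u : Sym2 (Fin n) → unitInterval) (A B : Finset (Fin n)) (x : Fin n) (j : ℕ),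
      x ∈ A → (∀ y ∈ B, y ∉ A) →
      (∀ y ∈ B, ∀ c ∈ A,
        (prodBernoulli u).real {ω : BondConfig (Fin n) |
            1 ≤ (A.filter fun z => ω ∈ openConn y z).card ∧ (A.filter fun z => ω ∈ openConn y z).card ≤ j} +
          (prodBernoulli u).real {ω : BondConfig (Fin n) | (A.filter fun z => ω ∈ openConn c z).card ≤ j} ≤
        (prodBernoulli u).real {ω : BondConfig (Fin n) |
            (A.filter fun z => ω ∈ openConn c z).card ≤ j ∧ 1 ≤ (A.filter fun z => ω ∈ openConn y z).card} +
          (prodBernoulli u).real {ω : BondConfig (Fin n) | (A.filter fun z => ω ∈ openConn x z).card ≤ j}) →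
      ∀ c ∈ A,
        (prodBernoulli u).real {ω : BondConfig (Fin n) |
            (∀ y ∈ B, ω ∉ openConn x y) ∧
              1 ≤ (A.filter fun z => ∃ y ∈ B, ω ∈ openConn y z).card ∧
              (A.filter fun z => ∃ y ∈ B, ω ∈ openConn y z).card ≤ j} +
          (prodBernoulli u).real {ω : BondConfig (Fin n) |
            ¬ 1 ≤ (A.filter fun z => ∃ y ∈ B, ω ∈ openConn y z).card ∧
              (A.filter fun z => ω ∈ openConn c z).card ≤ j} ≤
        (prodBernoulli u).real {ω : BondConfig (Fin n) |
            (∀ y ∈ B, ω ∉ openConn x y) ∧ (A.filter fun z => ω ∈ openConn x z).card ≤ j}) :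
    ∀ (n : ℕ) (w : Sym2 (Fin n) → unitInterval) (A B : Finset (Fin n)) (o q c : Fin n) (j : ℕ),
      (∀ (n' : ℕ) (w' : Sym2 (Fin n') → unitInterval) (A' : Finset (Fin n')) (o' q' c' : Fin n') (j' : ℕ),
        (Finset.univ.filter fun e : Sym2 (Fin n') => w' e ≠ 0).card <
          (Finset.univ.filter fun e : Sym2 (Fin n) => w e ≠ 0).card →
        o' ∉ A' → q' ∈ A' → c' ∈ A' →
        (∀ a ∈ A', (prodBernoulli w').real {ω : BondConfig (Fin n') | (A'.filter fun x => ω ∈ openConn a x).card ≤ j'} ≤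
          (prodBernoulli w').real {ω : BondConfig (Fin n') | (A'.filter fun x => ω ∈ openConn q' x).card ≤ j'}) →
        (prodBernoulli w').real {ω : BondConfig (Fin n') |
            1 ≤ (A'.filter fun x => ω ∈ openConn o' x).card ∧ (A'.filter fun x => ω ∈ openConn o' x).card ≤ j'} +
          (prodBernoulli w').real {ω : BondConfig (Fin n') | (A'.filter fun x => ω ∈ openConn c' x).card ≤ j'} ≤
        (prodBernoulli w').real {ω : BondConfig (Fin n') |
            (A'.filter fun x => ω ∈ openConn c' x).card ≤ j' ∧ 1 ≤ (A'.filter fun x => ω ∈ openConn o' x).card} +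
          (prodBernoulli w').real {ω : BondConfig (Fin n') | (A'.filter fun x => ω ∈ openConn q' x).card ≤ j'}) →
      o ∉ A → q ∈ A → c ∈ A → 2 ≤ B.card → (∀ y ∈ B, y ∉ A ∧ y ≠ o ∧ w s(o, y) ≠ 0) →
      (∀ a ∈ A, (prodBernoulli fun e => if e ∈ {e : Sym2 (Fin n) | o ∉ e} then w e else 0).real
          {ξ : BondConfig (Fin n) | (A.filter fun z => (openGraph ξ).Reachable a z).card ≤ j} ≤
        (prodBernoulli fun e => if e ∈ {e : Sym2 (Fin n) | o ∉ e} then w e else 0).real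
          {ξ : BondConfig (Fin n) | (A.filter fun z => (openGraph ξ).Reachable q z).card ≤ j}) →
      (∀ y ∈ B, (prodBernoulli fun e => if e ∈ {e : Sym2 (Fin n) | o ∉ e} then w e else 0).real
          {ξ : BondConfig (Fin n) | (A.filter fun z => (openGraph ξ).Reachable q z).card ≤ j} <
        (prodBernoulli fun e => if e ∈ {e : Sym2 (Fin n) | o ∉ e} then w e else 0).real
          {ξ : BondConfig (Fin n) | (A.filter fun z => (openGraph ξ).Reachable y z).card ≤ j}) →
      (prodBernoulli fun e => if e ∈ {e : Sym2 (Fin n) | o ∉ e} then w e else 0).real {ξ : BondConfig (Fin n) |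
          (∀ y ∈ B, ¬ (openGraph ξ).Reachable q y) ∧
            1 ≤ (A.filter fun z => ∃ y ∈ B, (openGraph ξ).Reachable y z).card ∧
            (A.filter fun z => ∃ y ∈ B, (openGraph ξ).Reachable y z).card ≤ j} +
        (prodBernoulli fun e => if e ∈ {e : Sym2 (Fin n) | o ∉ e} then w e else 0).real {ξ : BondConfig (Fin n) |
          ¬ 1 ≤ (A.filter fun z => ∃ y ∈ B, (openGraph ξ).Reachable y z).card ∧
            (A.filter fun z => (openGraph ξ).Reachable c z).card ≤ j} ≤
      (prodBernoulli fun e => if e ∈ {e : Sym2 (Fin n) | o ∉ e} then w e else 0).real {ξ : BondConfig (Fin n) |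
          (∀ y ∈ B, ¬ (openGraph ξ).Reachable q y) ∧ (A.filter fun z => (openGraph ξ).Reachable q z).card ≤ j} := by
  intro n w A B o q c j ih ho hq hc hB hBy hch _hl
  set u : Sym2 (Fin n) → unitInterval := fun e => if e ∈ {e : Sym2 (Fin n) | o ∉ e} then w e else 0 with hu
  -- `u` has fewer positive pairs than `w`: the pair `s(o, y₀)` (`y₀ ∈ B`) is positive for `w` and zero for `u`
  obtain ⟨y₀, hy₀⟩ : B.Nonempty := Finset.card_pos.1 (by omega)
  have hlt : (Finset.univ.filter fun e : Sym2 (Fin n) => u e ≠ 0).card <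
      (Finset.univ.filter fun e : Sym2 (Fin n) => w e ≠ 0).card := by
    refine Finset.card_lt_card ⟨fun e he => ?_, fun hsub => ?_⟩
    · rw [Finset.mem_filter] at he ⊢
      refine ⟨he.1, fun hwe => he.2 ?_⟩
      simp only [hu, mem_setOf_eq]
      split_ifs <;> simp [hwe]
    · have hmem : s(o, y₀) ∈ (Finset.univ.filter fun e : Sym2 (Fin n) => w e ≠ 0) :=
        Finset.mem_filter.2 ⟨Finset.mem_univ _, (hBy y₀ hy₀).2.2⟩
      have := Finset.mem_filter.1 (hsub hmem)
      apply this.2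
      simp only [hu, mem_setOf_eq, Sym2.mem_iff, true_or, not_true_eq_false, if_false]
  -- dictionary `(openGraph ξ).Reachable` ↔ `ξ ∈ openConn`
  have hfilt : ∀ (x : Fin n) (ξ : BondConfig (Fin n)),
      (A.filter fun z => (openGraph ξ).Reachable x z) = (A.filter fun z => ξ ∈ openConn x z) :=
    fun x ξ => Finset.filter_congr fun _ _ => Iff.rfl
  have hfiltB : ∀ (ξ : BondConfig (Fin n)),
      (A.filter fun z => ∃ y ∈ B, (openGraph ξ).Reachable y z) = (A.filter fun z => ∃ y ∈ B, ξ ∈ openConn y z) :=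
    fun ξ => Finset.filter_congr fun _ _ => Iff.rfl
  have eoc : ∀ (x : Fin n), {ξ : BondConfig (Fin n) | (A.filter fun z => (openGraph ξ).Reachable x z).card ≤ j} =
      {ξ : BondConfig (Fin n) | (A.filter fun z => ξ ∈ openConn x z).card ≤ j} := by
    intro x; ext ξ; simp only [mem_setOf_eq, hfilt x ξ]
  -- the champion hypothesis in `openConn` form
  have hch' : ∀ a ∈ A, (prodBernoulli u).real {ξ : BondConfig (Fin n) | (A.filter fun z => ξ ∈ openConn a z).card ≤ j} ≤
      (prodBernoulli u).real {ξ : BondConfig (Fin n) | (A.filter fun z => ξ ∈ openConn q z).card ≤ j} := by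
    intro a ha; rw [← eoc a, ← eoc q]; exact hch a ha
  -- the induction hypothesis: `q` is a T-witness for every member of `B` (an observer of `u`)
  have hW : ∀ y ∈ B, ∀ c' ∈ A,
      (prodBernoulli u).real {ω : BondConfig (Fin n) |
          1 ≤ (A.filter fun z => ω ∈ openConn y z).card ∧ (A.filter fun z => ω ∈ openConn y z).card ≤ j} +
        (prodBernoulli u).real {ω : BondConfig (Fin n) | (A.filter fun z => ω ∈ openConn c' z).card ≤ j} ≤
      (prodBernoulli u).real {ω : BondConfig (Fin n) |
          (A.filter fun z => ω ∈ openConn c' z).card ≤ j ∧ 1 ≤ (A.filter fun z => ω ∈ openConn y z).card} +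
        (prodBernoulli u).real {ω : BondConfig (Fin n) | (A.filter fun z => ω ∈ openConn q z).card ≤ j} :=
    fun y hy c' hc' => ih n u A y q c' j hlt (hBy y hy).1 hq hc' hch'
  -- glue
  have key := hGlue n u A B q j hq (fun y hy => (hBy y hy).1) hW c hc
  -- back to `Reachable` form
  have e1 : {ω : BondConfig (Fin n) | (∀ y ∈ B, ω ∉ openConn q y) ∧
        1 ≤ (A.filter fun z => ∃ y ∈ B, ω ∈ openConn y z).card ∧
        (A.filter fun z => ∃ y ∈ B, ω ∈ openConn y z).card ≤ j} =
      {ξ : BondConfig (Fin n) | (∀ y ∈ B, ¬ (openGraph ξ).Reachable q y) ∧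
        1 ≤ (A.filter fun z => ∃ y ∈ B, (openGraph ξ).Reachable y z).card ∧
        (A.filter fun z => ∃ y ∈ B, (openGraph ξ).Reachable y z).card ≤ j} := by
    ext ξ; simp only [mem_setOf_eq, hfiltB ξ]; exact Iff.rfl
  have e2 : {ω : BondConfig (Fin n) | ¬ 1 ≤ (A.filter fun z => ∃ y ∈ B, ω ∈ openConn y z).card ∧
        (A.filter fun z => ω ∈ openConn c z).card ≤ j} =
      {ξ : BondConfig (Fin n) | ¬ 1 ≤ (A.filter fun z => ∃ y ∈ B, (openGraph ξ).Reachable y z).card ∧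
        (A.filter fun z => (openGraph ξ).Reachable c z).card ≤ j} := by
    ext ξ; simp only [mem_setOf_eq, hfiltB ξ, hfilt c ξ]
  have e3 : {ω : BondConfig (Fin n) | (∀ y ∈ B, ω ∉ openConn q y) ∧ (A.filter fun z => ω ∈ openConn q z).card ≤ j} =
      {ξ : BondConfig (Fin n) | (∀ y ∈ B, ¬ (openGraph ξ).Reachable q y) ∧
        (A.filter fun z => (openGraph ξ).Reachable q z).card ≤ j} := by
    ext ξ; simp only [mem_setOf_eq, hfilt q ξ]; exact Iff.rfl
  rw [e1, e2, e3] at key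
  exact key

/-- **T-witnesses closed under gluing ⇒ the attached-champion inequality** (registered stub `stub_attachedChampion` verbatim). -/
theorem attachedChampion_of_gluedWitness
    (hGlue : ∀ (n : ℕ) (u : Sym2 (Fin n) → unitInterval) (A B : Finset (Fin n)) (x : Fin n) (j : ℕ),
      x ∈ A → (∀ y ∈ B, y ∉ A) →
      (∀ y ∈ B, ∀ c ∈ A,
        (prodBernoulli u).real {ω : BondConfig (Fin n) |
            1 ≤ (A.filter fun z => ω ∈ openConn y z).card ∧ (A.filter fun z => ω ∈ openConn y z).card ≤ j} +
          (prodBernoulli u).real {ω : BondConfig (Fin n) | (A.filter fun z => ω ∈ openConn c z).card ≤ j} ≤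
        (prodBernoulli u).real {ω : BondConfig (Fin n) |
            (A.filter fun z => ω ∈ openConn c z).card ≤ j ∧ 1 ≤ (A.filter fun z => ω ∈ openConn y z).card} +
          (prodBernoulli u).real {ω : BondConfig (Fin n) | (A.filter fun z => ω ∈ openConn x z).card ≤ j}) →
      ∀ c ∈ A,
        (prodBernoulli u).real {ω : BondConfig (Fin n) |
            (∀ y ∈ B, ω ∉ openConn x y) ∧
              1 ≤ (A.filter fun z => ∃ y ∈ B, ω ∈ openConn y z).card ∧
              (A.filter fun z => ∃ y ∈ B, ω ∈ openConn y z).card ≤ j} +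
          (prodBernoulli u).real {ω : BondConfig (Fin n) |
            ¬ 1 ≤ (A.filter fun z => ∃ y ∈ B, ω ∈ openConn y z).card ∧
              (A.filter fun z => ω ∈ openConn c z).card ≤ j} ≤
        (prodBernoulli u).real {ω : BondConfig (Fin n) |
            (∀ y ∈ B, ω ∉ openConn x y) ∧ (A.filter fun z => ω ∈ openConn x z).card ≤ j})
    (n : ℕ) (w : Sym2 (Fin n) → unitInterval) (A : Finset (Fin n)) (o q : Fin n) (j : ℕ) (ho : o ∉ A) (hq : q ∈ A)
    (hchamp : ∀ a ∈ A,
      (prodBernoulli w).real {ω : BondConfig (Fin n) | (A.filter fun x => ω ∈ openConn a x).card ≤ j} ≤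
        (prodBernoulli w).real {ω : BondConfig (Fin n) | (A.filter fun x => ω ∈ openConn q x).card ≤ j}) :
    (prodBernoulli w).real {ω : BondConfig (Fin n) |
        1 ≤ (A.filter fun x => ω ∈ openConn o x).card ∧ (A.filter fun x => ω ∈ openConn o x).card ≤ j} ≤
      (prodBernoulli w).real {ω : BondConfig (Fin n) |
        (A.filter fun x => ω ∈ openConn q x).card ≤ j ∧ 1 ≤ (A.filter fun x => ω ∈ openConn o x).card} :=
  attachedChampion_of_lightMultiStarPacking_open (lightMultiStarPacking_open_of_gluedWitness hGlue) n w A o q j ho hq hchamp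

/-- **T-witnesses closed under gluing ⇒ the crux `NoHeavyLowerTail`** (route `PercNearOneGluing` decl). -/
theorem noHeavyLowerTail_of_gluedWitness
    (hGlue : ∀ (n : ℕ) (u : Sym2 (Fin n) → unitInterval) (A B : Finset (Fin n)) (x : Fin n) (j : ℕ),
      x ∈ A → (∀ y ∈ B, y ∉ A) →
      (∀ y ∈ B, ∀ c ∈ A,
        (prodBernoulli u).real {ω : BondConfig (Fin n) |
            1 ≤ (A.filter fun z => ω ∈ openConn y z).card ∧ (A.filter fun z => ω ∈ openConn y z).card ≤ j} +
          (prodBernoulli u).real {ω : BondConfig (Fin n) | (A.filter fun z => ω ∈ openConn c z).card ≤ j} ≤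
        (prodBernoulli u).real {ω : BondConfig (Fin n) |
            (A.filter fun z => ω ∈ openConn c z).card ≤ j ∧ 1 ≤ (A.filter fun z => ω ∈ openConn y z).card} +
          (prodBernoulli u).real {ω : BondConfig (Fin n) | (A.filter fun z => ω ∈ openConn x z).card ≤ j}) →
      ∀ c ∈ A,
        (prodBernoulli u).real {ω : BondConfig (Fin n) |
            (∀ y ∈ B, ω ∉ openConn x y) ∧
              1 ≤ (A.filter fun z => ∃ y ∈ B, ω ∈ openConn y z).card ∧
              (A.filter fun z => ∃ y ∈ B, ω ∈ openConn y z).card ≤ j} +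
          (prodBernoulli u).real {ω : BondConfig (Fin n) |
            ¬ 1 ≤ (A.filter fun z => ∃ y ∈ B, ω ∈ openConn y z).card ∧
              (A.filter fun z => ω ∈ openConn c z).card ≤ j} ≤
        (prodBernoulli u).real {ω : BondConfig (Fin n) |
            (∀ y ∈ B, ω ∉ openConn x y) ∧ (A.filter fun z => ω ∈ openConn x z).card ≤ j}) :
    Summit.CriticalPhenomena.PercolationContinuityZ3.Theses.PercNearOneGluing.NoHeavyLowerTail :=
  noHeavyLowerTail_of_attachedChampion fun n w A o q j ho hq hchamp =>
    attachedChampion_of_gluedWitness hGlue n w A o q j ho hq hchamp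


/-! ### Corrected statements (gen 4, same day): the glued set must have at least two members

In the three theorems above the hypothesis `hGlue` quantifies over ALL finite sets `B`, including `B = ∅`, where its
conclusion degenerates to `μ(N_c ≤ j) ≤ μ(N_x ≤ j)` for every relay `c` with no hypothesis left — so `hGlue` as written is
unsatisfiable (take `x` a non-champion) and the three implications are vacuous.  The intended property only concerns sets
with `2 ≤ |B|` (for `|B| = 1` hypothesis and conclusion coincide); the versions below add `2 ≤ B.card` to `hGlue` and are the
ones to cite (census: run/shared/lean/ttrl/tcs/GLUEADM.md — 0 violations exhaustive + climbs; the variant with the singleton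
hypothesis only at `c` and `c′ = x` is FALSE by an exact 9-vertex witness, so "for every relay `c`" is essential). -/

/-- **Glued witnesses (sets with ≥ 2 members) discharge the light multi-star packing hypothesis of the open-recursion
induction** — corrected form of `lightMultiStarPacking_open_of_gluedWitness` (hypothesis restricted to `2 ≤ B.card`). -/
theorem lightMultiStarPacking_open_of_gluedWitness₂
    (hGlue : ∀ (n : ℕ) (u : Sym2 (Fin n) → unitInterval) (A B : Finset (Fin n)) (x : Fin n) (j : ℕ),
      x ∈ A → (∀ y ∈ B, y ∉ A) → 2 ≤ B.card →
      (∀ y ∈ B, ∀ c ∈ A,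
        (prodBernoulli u).real {ω : BondConfig (Fin n) |
            1 ≤ (A.filter fun z => ω ∈ openConn y z).card ∧ (A.filter fun z => ω ∈ openConn y z).card ≤ j} +
          (prodBernoulli u).real {ω : BondConfig (Fin n) | (A.filter fun z => ω ∈ openConn c z).card ≤ j} ≤
        (prodBernoulli u).real {ω : BondConfig (Fin n) |
            (A.filter fun z => ω ∈ openConn c z).card ≤ j ∧ 1 ≤ (A.filter fun z => ω ∈ openConn y z).card} +
          (prodBernoulli u).real {ω : BondConfig (Fin n) | (A.filter fun z => ω ∈ openConn x z).card ≤ j}) →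
      ∀ c ∈ A,
        (prodBernoulli u).real {ω : BondConfig (Fin n) |
            (∀ y ∈ B, ω ∉ openConn x y) ∧
              1 ≤ (A.filter fun z => ∃ y ∈ B, ω ∈ openConn y z).card ∧
              (A.filter fun z => ∃ y ∈ B, ω ∈ openConn y z).card ≤ j} +
          (prodBernoulli u).real {ω : BondConfig (Fin n) |
            ¬ 1 ≤ (A.filter fun z => ∃ y ∈ B, ω ∈ openConn y z).card ∧
              (A.filter fun z => ω ∈ openConn c z).card ≤ j} ≤
        (prodBernoulli u).real {ω : BondConfig (Fin n) |
            (∀ y ∈ B, ω ∉ openConn x y) ∧ (A.filter fun z => ω ∈ openConn x z).card ≤ j}) :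
    ∀ (n : ℕ) (w : Sym2 (Fin n) → unitInterval) (A B : Finset (Fin n)) (o q c : Fin n) (j : ℕ),
      (∀ (n' : ℕ) (w' : Sym2 (Fin n') → unitInterval) (A' : Finset (Fin n')) (o' q' c' : Fin n') (j' : ℕ),
        (Finset.univ.filter fun e : Sym2 (Fin n') => w' e ≠ 0).card <
          (Finset.univ.filter fun e : Sym2 (Fin n) => w e ≠ 0).card →
        o' ∉ A' → q' ∈ A' → c' ∈ A' →
        (∀ a ∈ A', (prodBernoulli w').real {ω : BondConfig (Fin n') | (A'.filter fun x => ω ∈ openConn a x).card ≤ j'} ≤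
          (prodBernoulli w').real {ω : BondConfig (Fin n') | (A'.filter fun x => ω ∈ openConn q' x).card ≤ j'}) →
        (prodBernoulli w').real {ω : BondConfig (Fin n') |
            1 ≤ (A'.filter fun x => ω ∈ openConn o' x).card ∧ (A'.filter fun x => ω ∈ openConn o' x).card ≤ j'} +
          (prodBernoulli w').real {ω : BondConfig (Fin n') | (A'.filter fun x => ω ∈ openConn c' x).card ≤ j'} ≤
        (prodBernoulli w').real {ω : BondConfig (Fin n') |
            (A'.filter fun x => ω ∈ openConn c' x).card ≤ j' ∧ 1 ≤ (A'.filter fun x => ω ∈ openConn o' x).card} +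
          (prodBernoulli w').real {ω : BondConfig (Fin n') | (A'.filter fun x => ω ∈ openConn q' x).card ≤ j'}) →
      o ∉ A → q ∈ A → c ∈ A → 2 ≤ B.card → (∀ y ∈ B, y ∉ A ∧ y ≠ o ∧ w s(o, y) ≠ 0) →
      (∀ a ∈ A, (prodBernoulli fun e => if e ∈ {e : Sym2 (Fin n) | o ∉ e} then w e else 0).real
          {ξ : BondConfig (Fin n) | (A.filter fun z => (openGraph ξ).Reachable a z).card ≤ j} ≤
        (prodBernoulli fun e => if e ∈ {e : Sym2 (Fin n) | o ∉ e} then w e else 0).real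
          {ξ : BondConfig (Fin n) | (A.filter fun z => (openGraph ξ).Reachable q z).card ≤ j}) →
      (∀ y ∈ B, (prodBernoulli fun e => if e ∈ {e : Sym2 (Fin n) | o ∉ e} then w e else 0).real
          {ξ : BondConfig (Fin n) | (A.filter fun z => (openGraph ξ).Reachable q z).card ≤ j} <
        (prodBernoulli fun e => if e ∈ {e : Sym2 (Fin n) | o ∉ e} then w e else 0).real
          {ξ : BondConfig (Fin n) | (A.filter fun z => (openGraph ξ).Reachable y z).card ≤ j}) →
      (prodBernoulli fun e => if e ∈ {e : Sym2 (Fin n) | o ∉ e} then w e else 0).real {ξ : BondConfig (Fin n) |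
          (∀ y ∈ B, ¬ (openGraph ξ).Reachable q y) ∧
            1 ≤ (A.filter fun z => ∃ y ∈ B, (openGraph ξ).Reachable y z).card ∧
            (A.filter fun z => ∃ y ∈ B, (openGraph ξ).Reachable y z).card ≤ j} +
        (prodBernoulli fun e => if e ∈ {e : Sym2 (Fin n) | o ∉ e} then w e else 0).real {ξ : BondConfig (Fin n) |
          ¬ 1 ≤ (A.filter fun z => ∃ y ∈ B, (openGraph ξ).Reachable y z).card ∧
            (A.filter fun z => (openGraph ξ).Reachable c z).card ≤ j} ≤
      (prodBernoulli fun e => if e ∈ {e : Sym2 (Fin n) | o ∉ e} then w e else 0).real {ξ : BondConfig (Fin n) |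
          (∀ y ∈ B, ¬ (openGraph ξ).Reachable q y) ∧ (A.filter fun z => (openGraph ξ).Reachable q z).card ≤ j} := by
  intro n w A B o q c j ih ho hq hc hB hBy hch _hl
  set u : Sym2 (Fin n) → unitInterval := fun e => if e ∈ {e : Sym2 (Fin n) | o ∉ e} then w e else 0 with hu
  -- `u` has fewer positive pairs than `w`: the pair `s(o, y₀)` (`y₀ ∈ B`) is positive for `w` and zero for `u`
  obtain ⟨y₀, hy₀⟩ : B.Nonempty := Finset.card_pos.1 (by omega)
  have hlt : (Finset.univ.filter fun e : Sym2 (Fin n) => u e ≠ 0).card <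
      (Finset.univ.filter fun e : Sym2 (Fin n) => w e ≠ 0).card := by
    refine Finset.card_lt_card ⟨fun e he => ?_, fun hsub => ?_⟩
    · rw [Finset.mem_filter] at he ⊢
      refine ⟨he.1, fun hwe => he.2 ?_⟩
      simp only [hu, mem_setOf_eq]
      split_ifs <;> simp [hwe]
    · have hmem : s(o, y₀) ∈ (Finset.univ.filter fun e : Sym2 (Fin n) => w e ≠ 0) :=
        Finset.mem_filter.2 ⟨Finset.mem_univ _, (hBy y₀ hy₀).2.2⟩
      have := Finset.mem_filter.1 (hsub hmem)
      apply this.2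
      simp only [hu, mem_setOf_eq, Sym2.mem_iff, true_or, not_true_eq_false, if_false]
  -- dictionary `(openGraph ξ).Reachable` ↔ `ξ ∈ openConn`
  have hfilt : ∀ (x : Fin n) (ξ : BondConfig (Fin n)),
      (A.filter fun z => (openGraph ξ).Reachable x z) = (A.filter fun z => ξ ∈ openConn x z) :=
    fun x ξ => Finset.filter_congr fun _ _ => Iff.rfl
  have hfiltB : ∀ (ξ : BondConfig (Fin n)),
      (A.filter fun z => ∃ y ∈ B, (openGraph ξ).Reachable y z) = (A.filter fun z => ∃ y ∈ B, ξ ∈ openConn y z) :=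
    fun ξ => Finset.filter_congr fun _ _ => Iff.rfl
  have eoc : ∀ (x : Fin n), {ξ : BondConfig (Fin n) | (A.filter fun z => (openGraph ξ).Reachable x z).card ≤ j} =
      {ξ : BondConfig (Fin n) | (A.filter fun z => ξ ∈ openConn x z).card ≤ j} := by
    intro x; ext ξ; simp only [mem_setOf_eq, hfilt x ξ]
  -- the champion hypothesis in `openConn` form
  have hch' : ∀ a ∈ A, (prodBernoulli u).real {ξ : BondConfig (Fin n) | (A.filter fun z => ξ ∈ openConn a z).card ≤ j} ≤
      (prodBernoulli u).real {ξ : BondConfig (Fin n) | (A.filter fun z => ξ ∈ openConn q z).card ≤ j} := by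
    intro a ha; rw [← eoc a, ← eoc q]; exact hch a ha
  -- the induction hypothesis: `q` is a T-witness for every member of `B` (an observer of `u`)
  have hW : ∀ y ∈ B, ∀ c' ∈ A,
      (prodBernoulli u).real {ω : BondConfig (Fin n) |
          1 ≤ (A.filter fun z => ω ∈ openConn y z).card ∧ (A.filter fun z => ω ∈ openConn y z).card ≤ j} +
        (prodBernoulli u).real {ω : BondConfig (Fin n) | (A.filter fun z => ω ∈ openConn c' z).card ≤ j} ≤
      (prodBernoulli u).real {ω : BondConfig (Fin n) |
          (A.filter fun z => ω ∈ openConn c' z).card ≤ j ∧ 1 ≤ (A.filter fun z => ω ∈ openConn y z).card} +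
        (prodBernoulli u).real {ω : BondConfig (Fin n) | (A.filter fun z => ω ∈ openConn q z).card ≤ j} :=
    fun y hy c' hc' => ih n u A y q c' j hlt (hBy y hy).1 hq hc' hch'
  -- glue
  have key := hGlue n u A B q j hq (fun y hy => (hBy y hy).1) hB hW c hc
  -- back to `Reachable` form
  have e1 : {ω : BondConfig (Fin n) | (∀ y ∈ B, ω ∉ openConn q y) ∧
        1 ≤ (A.filter fun z => ∃ y ∈ B, ω ∈ openConn y z).card ∧
        (A.filter fun z => ∃ y ∈ B, ω ∈ openConn y z).card ≤ j} =
      {ξ : BondConfig (Fin n) | (∀ y ∈ B, ¬ (openGraph ξ).Reachable q y) ∧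
        1 ≤ (A.filter fun z => ∃ y ∈ B, (openGraph ξ).Reachable y z).card ∧
        (A.filter fun z => ∃ y ∈ B, (openGraph ξ).Reachable y z).card ≤ j} := by
    ext ξ; simp only [mem_setOf_eq, hfiltB ξ]; exact Iff.rfl
  have e2 : {ω : BondConfig (Fin n) | ¬ 1 ≤ (A.filter fun z => ∃ y ∈ B, ω ∈ openConn y z).card ∧
        (A.filter fun z => ω ∈ openConn c z).card ≤ j} =
      {ξ : BondConfig (Fin n) | ¬ 1 ≤ (A.filter fun z => ∃ y ∈ B, (openGraph ξ).Reachable y z).card ∧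
        (A.filter fun z => (openGraph ξ).Reachable c z).card ≤ j} := by
    ext ξ; simp only [mem_setOf_eq, hfiltB ξ, hfilt c ξ]
  have e3 : {ω : BondConfig (Fin n) | (∀ y ∈ B, ω ∉ openConn q y) ∧ (A.filter fun z => ω ∈ openConn q z).card ≤ j} =
      {ξ : BondConfig (Fin n) | (∀ y ∈ B, ¬ (openGraph ξ).Reachable q y) ∧
        (A.filter fun z => (openGraph ξ).Reachable q z).card ≤ j} := by
    ext ξ; simp only [mem_setOf_eq, hfilt q ξ]; exact Iff.rfl
  rw [e1, e2, e3] at key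
  exact key

/-- **T-witnesses closed under gluing (≥ 2 members) ⇒ the attached-champion inequality** (registered stub
`stub_attachedChampion` verbatim) — corrected form of `attachedChampion_of_gluedWitness`. -/
theorem attachedChampion_of_gluedWitness₂
    (hGlue : ∀ (n : ℕ) (u : Sym2 (Fin n) → unitInterval) (A B : Finset (Fin n)) (x : Fin n) (j : ℕ),
      x ∈ A → (∀ y ∈ B, y ∉ A) → 2 ≤ B.card →
      (∀ y ∈ B, ∀ c ∈ A,
        (prodBernoulli u).real {ω : BondConfig (Fin n) |
            1 ≤ (A.filter fun z => ω ∈ openConn y z).card ∧ (A.filter fun z => ω ∈ openConn y z).card ≤ j} +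
          (prodBernoulli u).real {ω : BondConfig (Fin n) | (A.filter fun z => ω ∈ openConn c z).card ≤ j} ≤
        (prodBernoulli u).real {ω : BondConfig (Fin n) |
            (A.filter fun z => ω ∈ openConn c z).card ≤ j ∧ 1 ≤ (A.filter fun z => ω ∈ openConn y z).card} +
          (prodBernoulli u).real {ω : BondConfig (Fin n) | (A.filter fun z => ω ∈ openConn x z).card ≤ j}) →
      ∀ c ∈ A,
        (prodBernoulli u).real {ω : BondConfig (Fin n) |
            (∀ y ∈ B, ω ∉ openConn x y) ∧
              1 ≤ (A.filter fun z => ∃ y ∈ B, ω ∈ openConn y z).card ∧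
              (A.filter fun z => ∃ y ∈ B, ω ∈ openConn y z).card ≤ j} +
          (prodBernoulli u).real {ω : BondConfig (Fin n) |
            ¬ 1 ≤ (A.filter fun z => ∃ y ∈ B, ω ∈ openConn y z).card ∧
              (A.filter fun z => ω ∈ openConn c z).card ≤ j} ≤
        (prodBernoulli u).real {ω : BondConfig (Fin n) |
            (∀ y ∈ B, ω ∉ openConn x y) ∧ (A.filter fun z => ω ∈ openConn x z).card ≤ j})
    (n : ℕ) (w : Sym2 (Fin n) → unitInterval) (A : Finset (Fin n)) (o q : Fin n) (j : ℕ) (ho : o ∉ A) (hq : q ∈ A)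
    (hchamp : ∀ a ∈ A,
      (prodBernoulli w).real {ω : BondConfig (Fin n) | (A.filter fun x => ω ∈ openConn a x).card ≤ j} ≤
        (prodBernoulli w).real {ω : BondConfig (Fin n) | (A.filter fun x => ω ∈ openConn q x).card ≤ j}) :
    (prodBernoulli w).real {ω : BondConfig (Fin n) |
        1 ≤ (A.filter fun x => ω ∈ openConn o x).card ∧ (A.filter fun x => ω ∈ openConn o x).card ≤ j} ≤
      (prodBernoulli w).real {ω : BondConfig (Fin n) |
        (A.filter fun x => ω ∈ openConn q x).card ≤ j ∧ 1 ≤ (A.filter fun x => ω ∈ openConn o x).card} :=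
  attachedChampion_of_lightMultiStarPacking_open (lightMultiStarPacking_open_of_gluedWitness₂ hGlue) n w A o q j ho hq hchamp

/-- **T-witnesses closed under gluing (≥ 2 members) ⇒ the crux `NoHeavyLowerTail`** (route `PercNearOneGluing` decl) —
corrected form of `noHeavyLowerTail_of_gluedWitness`; THIS is the reduction of the crux to GLUE-ADM. -/
theorem noHeavyLowerTail_of_gluedWitness₂
    (hGlue : ∀ (n : ℕ) (u : Sym2 (Fin n) → unitInterval) (A B : Finset (Fin n)) (x : Fin n) (j : ℕ),
      x ∈ A → (∀ y ∈ B, y ∉ A) → 2 ≤ B.card →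
      (∀ y ∈ B, ∀ c ∈ A,
        (prodBernoulli u).real {ω : BondConfig (Fin n) |
            1 ≤ (A.filter fun z => ω ∈ openConn y z).card ∧ (A.filter fun z => ω ∈ openConn y z).card ≤ j} +
          (prodBernoulli u).real {ω : BondConfig (Fin n) | (A.filter fun z => ω ∈ openConn c z).card ≤ j} ≤
        (prodBernoulli u).real {ω : BondConfig (Fin n) |
            (A.filter fun z => ω ∈ openConn c z).card ≤ j ∧ 1 ≤ (A.filter fun z => ω ∈ openConn y z).card} +
          (prodBernoulli u).real {ω : BondConfig (Fin n) | (A.filter fun z => ω ∈ openConn x z).card ≤ j}) →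
      ∀ c ∈ A,
        (prodBernoulli u).real {ω : BondConfig (Fin n) |
            (∀ y ∈ B, ω ∉ openConn x y) ∧
              1 ≤ (A.filter fun z => ∃ y ∈ B, ω ∈ openConn y z).card ∧
              (A.filter fun z => ∃ y ∈ B, ω ∈ openConn y z).card ≤ j} +
          (prodBernoulli u).real {ω : BondConfig (Fin n) |
            ¬ 1 ≤ (A.filter fun z => ∃ y ∈ B, ω ∈ openConn y z).card ∧
              (A.filter fun z => ω ∈ openConn c z).card ≤ j} ≤
        (prodBernoulli u).real {ω : BondConfig (Fin n) |
            (∀ y ∈ B, ω ∉ openConn x y) ∧ (A.filter fun z => ω ∈ openConn x z).card ≤ j}) :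
    Summit.CriticalPhenomena.PercolationContinuityZ3.Theses.PercNearOneGluing.NoHeavyLowerTail :=
  noHeavyLowerTail_of_attachedChampion fun n w A o q j ho hq hchamp =>
    attachedChampion_of_gluedWitness₂ hGlue n w A o q j ho hq hchamp

end Summit.CriticalPhenomena.PercolationContinuityZ3.Theorems

end
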